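import Literature.Analysis.FluidPDE.CaloricDualityTerms
import Mathlib.MeasureTheory.Measure.Haar.NormedSpace
import HarnessLib

/-!
# The caloric test fields as space–time potentials for every viscosity, and the duality passage
# for integrable data

Analysis/FluidPDE support file (everything proved) in the decomposition of the named fact
`Literature.Analysis.FluidPDE.LemarieRieusset2016.lemma13_6_duhamel` (`CKNMorreyHolder.lean`:
Lemarié-Rieusset 2016, §13.9 Step 3, (13.50)–(13.52), and the proof of Lemma 13.6,
pp. 474–478: the localised velocity `φu` is the Duhamel integral of the data of its equation).
The tree proves the localised equations **by duality** (`CKNMorreyDualIdentity.lean`: the master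
identity `∫_Q φ g u_c = ∫_Q AV + ∫_Q BV` for every viscosity `ν > 0` and a divergence-free force),
each term being a pairing `∫ F · X` of a data function `F` with one of the caloric fields
`η = 𝒰_ν[g]`, `∂ᵥη`, `Ξ = 𝒰_ν[∂_c N g]`, `∂ᵥΞ`, `∂ᵤ∂ᵥΞ`, `L = 𝒰_ν[Λ ∂_c g]`. To turn the master
identity into the *representation* `φu = Σ potentials` one needs each field as a space–time
convolution `K ⋆ g̃` with an explicit backward kernel, and the adjoint passage
`∫ F · (K ⋆ g̃) = ∫ g̃ · (Ǩ ⋆ F)`. The tree has both for `ν = 1` and *bounded* data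
(`CaloricDuhamelRepresentation.lean`, `CaloricDualityTerms.lean`, serving Seregin–Šverák); this
file supplies them for **every viscosity** and for **integrable data**:

* `backKernel_timeScale`, `IsSliceBoundKernel.timeScale`, `IsOffDiagKernel.timeScale` — the
  backward kernel of the rescaled family `a ↦ κ(νa)` is the time-rescaled backward kernel, and the
  two kernel classes of `CaloricKernelFamilies.lean` are stable under `τ ↦ ντ` (`ν > 0`);
* `heatDuhamelBack_eq_convolution_backKernel_nu` — the mechanism
  `𝒰_ν[Θ](s)(x) = (backKernel (κ(ν·)) ⋆ g̃)(s, x)` from the slice identities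
  `e^{νσΔ}Θ(s + σ)(x) = ∫ κ(νσ, y) g(s + σ, x - y) dy`;
* the six representations for general `ν`: `heatDuhamelBack_eq_convolution_heatKernel_nu` (`η`),
  `fderiv_heatDuhamelBack_eq_convolution_heatKernelGrad_nu` (`∂ᵥη`),
  `heatDuhamelBack_fderiv_newtonNearPotential_eq_convolution_nu` (`Ξ`),
  `fderiv_heatDuhamelBack_fderiv_newtonNearPotential_eq_convolution_nu` (`∂ᵥΞ`, off the
  diagonal), `fderiv_fderiv_heatDuhamelBack_fderiv_newtonNearPotential_eq_convolution_nu`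
  (`∂ᵤ∂ᵥΞ`), `heatDuhamelBack_newtonFarSmoothing_fderiv_eq_convolution_nu` (`L`);
* `integrable_kernelPairing_of_sliceBound_swap` — **absolute convergence for integrable data**:
  `F(z) K(z - w) g̃(w)` is integrable on the product when `K` is slice-bound, `F ∈ L¹` has bounded
  time support and `g̃` is bounded, integrable, with bounded time support (the rôles of the two
  factors in the tree's `integrable_kernelPairing_of_sliceBound` exchanged);
* `duality_term_sliceBound_integrable` — the adjoint passage `∫ F · X = ∫ g̃ · (Ǩ ⋆ F)` for
  slice-bound kernels and integrable data with bounded time support.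

## Mathlib / tree search

Tree (all used): `backKernel`, `IsSliceBoundKernel`, `IsOffDiagKernel` and their constructors
(`CaloricBackwardKernels`, `CaloricKernelFamilies`), the `ν = 1` representations and slice
identities (`CaloricDuhamelRepresentation`), `integral_mul_convolution_comm`,
`lintegral_indicator_fst_sub_mul_enorm_sub_left_le` (`CaloricPotentialContinuity`),
`heatDuhamelBack`, `IsSpaceTimeTestOn.fderiv_heatDuhamelBack_apply` (`HeatDuhamelBack`),
`IsSpaceTimeTestOn.heatDuhamelBack_eq_convolution` (`HeatDuhamelSmooth`). Mathlib:
`Integrable.comp_mul_left'`, `integrable_prod_iff`, `integral_prod`, `integral_comp_neg_Ioi`.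

## References

* P. G. Lemarié-Rieusset, *The Navier–Stokes Problem in the 21st Century*, CRC Press (2016),
  Prop. 4.3 p. 74 (Duhamel integrals), §13.9 Step 3, (13.50)–(13.52), pp. 474–475.
  [LemarieRieusset2016]
* L. C. Evans, *Partial Differential Equations*, 2nd ed. (AMS 2010), §2.3.1 (Duhamel's formula).
-/

noncomputable section

open MeasureTheory Set Function Filter Metric Real ContinuousLinearMap TopologicalSpace
open scoped ENNReal NNReal Topology RealInnerProductSpace Convolution Laplacian

namespace Literature.Analysis.FluidPDE

section General

variable {E : Type*} [NormedAddCommGroup E] [InnerProductSpace ℝ E] [FiniteDimensional ℝ E]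
  [MeasurableSpace E] [BorelSpace E]

/-! ### Time scaling of backward kernels and of the two kernel classes -/

omit [NormedAddCommGroup E] [InnerProductSpace ℝ E] [FiniteDimensional ℝ E] [MeasurableSpace E]
  [BorelSpace E] in
/-- **The backward kernel of the rescaled family is the time-rescaled backward kernel**:
`backKernel (a ↦ κ(νa)) (τ, y) = backKernel κ (ντ, y)` for `ν > 0`. [folklore] -/
theorem backKernel_timeScale (κ : ℝ → E → ℝ) {ν : ℝ} (hν : 0 < ν) (p : ℝ × E) :
    backKernel (fun a y => κ (ν * a) y) p = backKernel κ (ν * p.1, p.2) := by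
  unfold backKernel
  by_cases h : p.1 < 0
  · have h' : ν * p.1 < 0 := mul_neg_of_pos_of_neg hν h
    simp only [h, h', if_true, mul_neg]
  · have h' : ¬ν * p.1 < 0 := not_lt.2 (mul_nonneg hν.le (not_lt.1 h))
    simp only [h, h', if_false]

omit [NormedAddCommGroup E] [InnerProductSpace ℝ E] [FiniteDimensional ℝ E] [MeasurableSpace E]
  [BorelSpace E] in
/-- The same as an identity of functions: composition with `(τ, y) ↦ (ντ, y)`. [folklore] -/
theorem backKernel_timeScale_eq_comp (κ : ℝ → E → ℝ) {ν : ℝ} (hν : 0 < ν) :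
    backKernel (fun a y => κ (ν * a) y) = backKernel κ ∘ fun p : ℝ × E => ((ν * p.1, p.2) : ℝ × E) :=
  funext fun p => backKernel_timeScale κ hν p

omit [InnerProductSpace ℝ E] [FiniteDimensional ℝ E] [MeasurableSpace E] [BorelSpace E] in
/-- The time-scaling map `(τ, y) ↦ (ντ, y)` is continuous. [folklore] -/
theorem continuous_timeScaleMap (ν : ℝ) : Continuous fun p : ℝ × E => ((ν * p.1, p.2) : ℝ × E) := by
  fun_prop

/-- Local integrability on `ℝ` is stable under `τ ↦ ντ`, `ν > 0`. [folklore] -/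
theorem locallyIntegrable_comp_mul_left {N : ℝ → ℝ} (hN : LocallyIntegrable N volume) {ν : ℝ}
    (hν : 0 < ν) : LocallyIntegrable (fun τ => N (ν * τ)) volume := by
  rw [locallyIntegrable_iff]
  intro k hk
  obtain ⟨R, hR⟩ := hk.isBounded.subset_closedBall 0
  rw [Real.closedBall_eq_Icc, zero_sub, zero_add] at hR
  -- integrability on `[-R, R]`
  have h1 : IntegrableOn N (Icc (ν * -R) (ν * R)) volume := hN.integrableOn_isCompact isCompact_Icc
  have h2 : Integrable ((Icc (ν * -R) (ν * R)).indicator N) volume :=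
    (integrable_indicator_iff measurableSet_Icc).2 h1
  have h3 := h2.comp_mul_left' hν.ne'
  have h4 : (fun τ : ℝ => (Icc (ν * -R) (ν * R)).indicator N (ν * τ)) =
      (Icc (-R) R).indicator fun τ => N (ν * τ) := by
    funext τ
    simp only [indicator_apply, mem_Icc]
    have : (ν * -R ≤ ν * τ ∧ ν * τ ≤ ν * R) ↔ (-R ≤ τ ∧ τ ≤ R) := by
      rw [mul_le_mul_iff_right₀ hν, mul_le_mul_iff_right₀ hν]
    simp only [this]
  rw [h4, integrable_indicator_iff measurableSet_Icc] at h3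
  exact h3.mono_set hR

/-- **Slice-bound backward kernels are stable under time scaling**: if `backKernel κ` is
slice-bound with majorant `N`, then `backKernel (a ↦ κ(νa))` is slice-bound with majorant
`τ ↦ N(ντ)` (`ν > 0`). [folklore] -/
theorem IsSliceBoundKernel.timeScale {κ : ℝ → E → ℝ} {N : ℝ → ℝ}
    (hK : IsSliceBoundKernel (backKernel κ) N) {ν : ℝ} (hν : 0 < ν) :
    IsSliceBoundKernel (backKernel fun a y => κ (ν * a) y) (fun τ => N (ν * τ)) where
  measurable := by
    rw [backKernel_timeScale_eq_comp κ hν]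
    exact hK.measurable.comp (continuous_timeScaleMap ν).measurable
  slice_le τ := by
    simp only [backKernel_timeScale κ hν]
    exact hK.slice_le (ν * τ)
  nonneg τ := hK.nonneg _
  locallyIntegrable := locallyIntegrable_comp_mul_left hK.locallyIntegrable hν
  bdd ε hε := by
    obtain ⟨B, hB⟩ := hK.bdd (ν * ε) (mul_pos hν hε)
    refine ⟨B, fun p hp => ?_⟩
    rw [backKernel_timeScale κ hν]
    apply hB
    show ν * ε ≤ |ν * p.1|
    rw [abs_mul, abs_of_pos hν]
    exact mul_le_mul_of_nonneg_left hp hν.le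
  continuousAt p hp := by
    rw [backKernel_timeScale_eq_comp κ hν]
    refine ContinuousAt.comp ?_ (continuous_timeScaleMap ν).continuousAt
    exact hK.continuousAt _ (mul_ne_zero hν.ne' hp)

omit [InnerProductSpace ℝ E] [FiniteDimensional ℝ E] in
/-- **Off-diagonal backward kernels are stable under time scaling.** [folklore] -/
theorem IsOffDiagKernel.timeScale {κ : ℝ → E → ℝ} {D : Set E}
    (hK : IsOffDiagKernel (backKernel κ) D) {ν : ℝ} (hν : 0 < ν) :
    IsOffDiagKernel (backKernel fun a y => κ (ν * a) y) D where
  measurable := by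
    rw [backKernel_timeScale_eq_comp κ hν]
    exact hK.measurable.comp (continuous_timeScaleMap ν).measurable
  bdd := by
    obtain ⟨B, hB⟩ := hK.bdd
    refine ⟨B, fun τ y hy => ?_⟩
    rw [backKernel_timeScale κ hν]
    exact hB _ y hy
  continuousAt τ hτ y hy := by
    rw [backKernel_timeScale_eq_comp κ hν]
    refine ContinuousAt.comp (x := (τ, y)) ?_ (continuous_timeScaleMap ν).continuousAt
    exact hK.continuousAt _ (mul_ne_zero hν.ne' hτ) y hy

/-! ### The mechanism for general viscosity -/

/-- **`heatDuhamelBack ν Θ = backKernel (κ(ν·)) ⋆ g̃`** from the slice identities: if for every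
`σ > 0` one has `e^{νσΔ}(Θ(s + σ))(x) = ∫ κ(νσ, y) g(s + σ, x - y) dy` and the resulting double
integral at `(s, x)` converges absolutely, then
`𝒰_ν[Θ](s)(x) = (backKernel (a ↦ κ(νa)) ⋆ uncurry g)(s, x)` (Fubini and the substitution
`σ = -τ`; the tree's `heatDuhamelBack_one_eq_convolution_backKernel` for every `ν`). [folklore] -/
theorem heatDuhamelBack_eq_convolution_backKernel_nu {κ : ℝ → E → ℝ} {Θ g : ℝ → E → ℝ} {ν : ℝ}
    (s : ℝ) (x : E)
    (hslice : ∀ σ : ℝ, 0 < σ →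
      UnboundedOperators.heatExtension (Θ (s + σ)) (ν * σ) x = ∫ y, κ (ν * σ) y * g (s + σ) (x - y))
    (hint : Integrable (fun q : ℝ × E => backKernel (fun a y => κ (ν * a) y) q * g (s - q.1) (x - q.2))
      (volume : Measure (ℝ × E))) :
    heatDuhamelBack ν Θ s x =
      (backKernel (fun a y => κ (ν * a) y) ⋆[lsmul ℝ ℝ, (volume : Measure (ℝ × E))] uncurry g)
        (s, x) := by
  rw [convolution_def]
  have hF : (fun q : ℝ × E => (lsmul ℝ ℝ) (backKernel (fun a y => κ (ν * a) y) q)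
      (uncurry g ((s, x) - q))) =
      fun q : ℝ × E => backKernel (fun a y => κ (ν * a) y) q * g (s - q.1) (x - q.2) := by
    funext q; rfl
  rw [hF, Measure.volume_eq_prod, integral_prod _ (by rwa [← Measure.volume_eq_prod])]
  have hsl : ∀ τ : ℝ, (∫ y : E, (fun q : ℝ × E =>
      backKernel (fun a y => κ (ν * a) y) q * g (s - q.1) (x - q.2)) (τ, y)) =
      if τ < 0 then ∫ y, κ (ν * -τ) y * g (s - τ) (x - y) else 0 := by
    intro τ
    by_cases hτ : τ < 0
    · simp only [backKernel_of_neg _ hτ, hτ, if_true]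
    · simp only [backKernel_of_nonneg _ (not_lt.1 hτ), hτ, if_false, zero_mul, integral_zero]
  simp_rw [hsl]
  have hind : (fun τ : ℝ => if τ < 0 then ∫ y, κ (ν * -τ) y * g (s - τ) (x - y) else 0) =
      (Iio (0 : ℝ)).indicator fun τ => ∫ y, κ (ν * -τ) y * g (s - τ) (x - y) := by
    funext τ; simp only [Set.indicator_apply, mem_Iio]
  rw [hind, integral_indicator measurableSet_Iio, ← integral_Iic_eq_integral_Iio,
    heatDuhamelBack_apply]
  have h := integral_comp_neg_Ioi 0 (fun τ => ∫ y, κ (ν * -τ) y * g (s - τ) (x - y))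
  simp only [neg_zero, neg_neg, sub_neg_eq_add] at h
  rw [← h]
  refine setIntegral_congr_fun measurableSet_Ioi fun σ hσ => ?_
  exact hslice σ hσ

/-! ### `η = 𝒰_ν[g]` and its gradient -/

omit [FiniteDimensional ℝ E] [MeasurableSpace E] [BorelSpace E] in
/-- The backward space–time heat kernel with viscosity `ν` is the backward kernel of the family
`a ↦ G_{νa}`. [folklore] -/
theorem heatDuhamelKernel_eq_backKernel (ν : ℝ) :
    heatDuhamelKernel (E := E) ν = backKernel fun a y => UnboundedOperators.heatKernel (ν * a) y := by
  funext p
  unfold heatDuhamelKernel backKernel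
  by_cases h : p.1 < 0 <;> simp [h]

/-- **`𝒰_ν[g]` is the heat potential of `g`**:
`heatDuhamelBack ν g s x = (backKernel (a ↦ G_{νa}) ⋆ g̃)(s, x)`. [folklore] -/
theorem heatDuhamelBack_eq_convolution_heatKernel_nu {g : ℝ → E → ℝ}
    (hg : IsSpaceTimeTestOn (⊤ : Opens (ℝ × E)) g) {ν : ℝ} (hν : 0 < ν) (s : ℝ) (x : E) :
    heatDuhamelBack ν g s x =
      (backKernel (fun a y => UnboundedOperators.heatKernel (E := E) (ν * a) y) ⋆[lsmul ℝ ℝ,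
        (volume : Measure (ℝ × E))] uncurry g) (s, x) := by
  rw [hg.heatDuhamelBack_eq_convolution hν s x, heatDuhamelKernel_eq_backKernel]

/-- **The gradient of `𝒰_ν[g]` is the potential of `g` against the backward heat-gradient kernel
of the rescaled family**: `∂ᵥ(𝒰_ν[g](s))(x) = (backKernel (a ↦ ∂ᵥG_{νa}) ⋆ g̃)(s, x)`. [folklore] -/
theorem fderiv_heatDuhamelBack_eq_convolution_heatKernelGrad_nu {g : ℝ → E → ℝ}
    (hg : IsSpaceTimeTestOn (⊤ : Opens (ℝ × E)) g) {ν : ℝ} (hν : 0 < ν) (s : ℝ) (x v : E) :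
    fderiv ℝ (heatDuhamelBack ν g s) x v =
      (backKernel (fun a y => heatKernelGrad v (ν * a) y) ⋆[lsmul ℝ ℝ, (volume : Measure (ℝ × E))]
        uncurry g) (s, x) := by
  rw [hg.fderiv_heatDuhamelBack_apply hν s x v]
  refine heatDuhamelBack_eq_convolution_backKernel_nu s x (fun σ hσ => ?_)
    (((isSliceBoundKernel_backKernel_heatKernelGrad v).timeScale hν).integrable_backKernel_mul_test
      hg s x)
  exact heatExtension_fderiv_apply_eq_integral_heatKernelGrad (hg.contDiff_slice (s + σ))
    (hg.hasCompactSupport_slice (s + σ)) (mul_pos hν hσ) v x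

/-! ### Absolute convergence for integrable data, and the duality passage -/

/-- **Absolute convergence, integrable-data case**: data `f ∈ L¹` with time support in
`[a, b]`, `g ∈ L¹` bounded by `M` with time support in `[a', b']`, and a measurable kernel whose
time slices satisfy `∫ |K(τ, y)| dy ≤ N(τ)` with `N ≥ 0` integrable on `[a - b', b - a']`. Then
`f(z) K(z - w) g(w)` is integrable on the product (integrate in `w` first:
`∫ |K(z - w)| |g(w)| dw ≤ M ∫_{[a-b', b-a']} N` for `z.1 ∈ [a, b]`). This is the tree's
`integrable_kernelPairing_of_sliceBound` with the rôles of `f` and `g` exchanged. [folklore] -/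
theorem integrable_kernelPairing_of_sliceBound_swap {K f g : ℝ × E → ℝ} {N : ℝ → ℝ}
    {M a b a' b' : ℝ} (hKm : Measurable K)
    (hN : ∀ τ : ℝ, ∫⁻ y, ‖K (τ, y)‖ₑ ≤ ENNReal.ofReal (N τ)) (hN0 : ∀ τ, 0 ≤ N τ)
    (hNint : IntegrableOn N (Icc (a - b') (b - a')) volume)
    (hf : Integrable f volume)
    (hfsupp : ∀ᵐ z ∂(volume : Measure (ℝ × E)), f z ≠ 0 → z.1 ∈ Icc a b)
    (hg : Integrable g volume) (hM : 0 ≤ M)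
    (hgM : ∀ᵐ w ∂(volume : Measure (ℝ × E)), |g w| ≤ M)
    (hgsupp : ∀ᵐ w ∂(volume : Measure (ℝ × E)), g w ≠ 0 → w.1 ∈ Icc a' b') :
    Integrable (fun p : (ℝ × E) × (ℝ × E) => f p.1 * (K (p.1 - p.2) * g p.2))
      ((volume : Measure (ℝ × E)).prod volume) := by
  have hm := aestronglyMeasurable_kernelPairing hKm hf.aestronglyMeasurable hg.aestronglyMeasurable
  rw [integrable_prod_iff hm]
  set C : ℝ≥0∞ := ∫⁻ τ in Icc (a - b') (b - a'), ENNReal.ofReal (N τ) with hC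
  have hCfin : C < ∞ := by
    rw [hC, ← ofReal_integral_eq_lintegral_ofReal hNint (ae_of_all _ hN0)]
    exact ENNReal.ofReal_lt_top
  -- the key pointwise-in-`z` bound
  have hkey : ∀ z : ℝ × E, z.1 ∈ Icc a b →
      ∫⁻ w, ‖f z * (K (z - w) * g w)‖ₑ ≤ ‖f z‖ₑ * (ENNReal.ofReal M * C) := by
    intro z hz
    calc ∫⁻ w, ‖f z * (K (z - w) * g w)‖ₑ
        ≤ ∫⁻ w : ℝ × E, ‖f z‖ₑ * (ENNReal.ofReal M *
            ((Icc (z.1 - b') (z.1 - a')).indicator (fun _ => (1 : ℝ≥0∞)) (z.1 - w.1) *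
              ‖K (z - w)‖ₑ)) := by
          refine lintegral_mono_ae ?_
          filter_upwards [hgM, hgsupp] with w hwM hws
          by_cases hg0 : g w = 0
          · simp [hg0]
          have hw1 := hws hg0
          have hind : (Icc (z.1 - b') (z.1 - a')).indicator (fun _ => (1 : ℝ≥0∞)) (z.1 - w.1) = 1 := by
            rw [indicator_of_mem]
            constructor <;> linarith [hw1.1, hw1.2]
          rw [hind, one_mul, enorm_mul, enorm_mul]
          have : ‖g w‖ₑ ≤ ENNReal.ofReal M := by
            rw [Real.enorm_eq_ofReal_abs]
            exact ENNReal.ofReal_le_ofReal hwM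
          calc ‖f z‖ₑ * (‖K (z - w)‖ₑ * ‖g w‖ₑ) ≤ ‖f z‖ₑ * (‖K (z - w)‖ₑ * ENNReal.ofReal M) := by
                gcongr
            _ = ‖f z‖ₑ * (ENNReal.ofReal M * ‖K (z - w)‖ₑ) := by ring
      _ = ‖f z‖ₑ * (ENNReal.ofReal M * ∫⁻ w : ℝ × E,
            (Icc (z.1 - b') (z.1 - a')).indicator (fun _ => (1 : ℝ≥0∞)) (z.1 - w.1) *
              ‖K (z - w)‖ₑ) := by
          rw [lintegral_const_mul' _ _ enorm_ne_top, lintegral_const_mul' _ _ ENNReal.ofReal_ne_top]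
      _ ≤ ‖f z‖ₑ * (ENNReal.ofReal M * ∫⁻ τ in Icc (z.1 - b') (z.1 - a'), ENNReal.ofReal (N τ)) := by
          gcongr
          exact lintegral_indicator_fst_sub_mul_enorm_sub_left_le hKm hN measurableSet_Icc z
      _ ≤ ‖f z‖ₑ * (ENNReal.ofReal M * C) := by
          gcongr
          exact lintegral_mono_set (Icc_subset_Icc (by linarith [hz.1]) (by linarith [hz.2]))
  have hmw : ∀ z : ℝ × E,
      AEStronglyMeasurable (fun w : ℝ × E => f z * (K (z - w) * g w)) volume := fun z =>
    aestronglyMeasurable_const.mul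
      (((hKm.comp (measurable_const.sub measurable_id)).aestronglyMeasurable).mul
        hg.aestronglyMeasurable)
  have hne : ∀ z : ℝ × E, ‖f z‖ₑ * (ENNReal.ofReal M * C) ≠ ∞ := fun z =>
    (ENNReal.mul_lt_top enorm_lt_top (ENNReal.mul_lt_top ENNReal.ofReal_lt_top hCfin)).ne
  constructor
  · -- integrability in `w` for a.e. `z`
    filter_upwards [hfsupp] with z hzs
    by_cases hf0 : f z = 0
    · have : (fun w : ℝ × E => f z * (K (z - w) * g w)) = fun _ => 0 := by
        funext w; simp [hf0]
      rw [this]; exact integrable_zero _ _ _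
    refine ⟨hmw z, ?_⟩
    rw [hasFiniteIntegral_iff_enorm]
    exact (hkey z (hzs hf0)).trans_lt (lt_top_iff_ne_top.2 (hne z))
  · -- the norm integral is dominated by `(M C) |f|`
    have hmeas2 : AEStronglyMeasurable (fun z : ℝ × E => ∫ w, ‖f z * (K (z - w) * g w)‖)
        volume := hm.norm.integral_prod_right'
    refine (hf.norm.mul_const (M * C.toReal)).mono' hmeas2 ?_
    filter_upwards [hfsupp] with z hzs
    rw [Real.norm_eq_abs, abs_of_nonneg (integral_nonneg fun _ => norm_nonneg _)]
    by_cases hf0 : f z = 0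
    · simp [hf0]
    rw [integral_norm_eq_lintegral_enorm (hmw z)]
    calc (∫⁻ w, ‖f z * (K (z - w) * g w)‖ₑ).toReal ≤ (‖f z‖ₑ * (ENNReal.ofReal M * C)).toReal :=
          ENNReal.toReal_mono (hne z) (hkey z (hzs hf0))
      _ = ‖f z‖ * (M * C.toReal) := by
          rw [ENNReal.toReal_mul, ENNReal.toReal_mul, ENNReal.toReal_ofReal hM, toReal_enorm]

/-- The same for a slice-bound kernel in the sense of `CaloricKernelFamilies`. [folklore] -/
theorem IsSliceBoundKernel.integrable_kernelPairing_swap {K : ℝ × E → ℝ} {N : ℝ → ℝ}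
    (hK : IsSliceBoundKernel K N) {f g : ℝ × E → ℝ} {M a b a' b' : ℝ}
    (hf : Integrable f volume)
    (hfsupp : ∀ᵐ z ∂(volume : Measure (ℝ × E)), f z ≠ 0 → z.1 ∈ Icc a b)
    (hg : Integrable g volume) (hM : 0 ≤ M)
    (hgM : ∀ᵐ w ∂(volume : Measure (ℝ × E)), |g w| ≤ M)
    (hgsupp : ∀ᵐ w ∂(volume : Measure (ℝ × E)), g w ≠ 0 → w.1 ∈ Icc a' b') :
    Integrable (fun p : (ℝ × E) × (ℝ × E) => f p.1 * (K (p.1 - p.2) * g p.2))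
      ((volume : Measure (ℝ × E)).prod volume) :=
  integrable_kernelPairing_of_sliceBound_swap hK.measurable hK.slice_le hK.nonneg
    (hK.locallyIntegrable.integrableOn_isCompact isCompact_Icc) hf hfsupp hg hM hgM hgsupp

/-- **Duality passage for slice-bound kernels and integrable data**: let `K = backKernel κ` be
slice-bound, `g` a space–time test function, `f ∈ L¹` with bounded time support, and `X` a field
with `X = K ⋆ g̃` wherever `f ≠ 0`. Then `∫ f X = ∫ g̃ (Ǩ ⋆ f)`, `Ǩ(v) = K(-v)` (the adjoint
identity `integral_mul_convolution_comm` under the absolute convergence of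
`integrable_kernelPairing_swap`). [folklore] -/
theorem duality_term_sliceBound_integrable {κ : ℝ → E → ℝ} {N : ℝ → ℝ}
    (hK : IsSliceBoundKernel (backKernel κ) N)
    {g : ℝ → E → ℝ} (hg : IsSpaceTimeTestOn (⊤ : Opens (ℝ × E)) g) {f X : ℝ × E → ℝ}
    (hX : ∀ z, f z ≠ 0 → X z = (backKernel κ ⋆[lsmul ℝ ℝ, (volume : Measure (ℝ × E))] uncurry g) z)
    (hfi : Integrable f volume) {a b : ℝ}
    (hfsupp : ∀ᵐ z ∂(volume : Measure (ℝ × E)), f z ≠ 0 → z.1 ∈ Icc a b) :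
    ∫ z, f z * X z =
      ∫ z, uncurry g z * ((fun v => backKernel κ (-v)) ⋆[lsmul ℝ ℝ, (volume : Measure (ℝ × E))] f) z := by
  obtain ⟨M, hM0, hM⟩ := hg.exists_norm_le
  obtain ⟨a', b', hab'⟩ := hg.exists_time_support
  have hgi := hg.integrable_uncurry
  have hgsupp : ∀ w : ℝ × E, uncurry g w ≠ 0 → w.1 ∈ Icc a' b' := fun w hw => by
    by_contra h
    exact hw (by simp only [uncurry]; rw [hab' w.1 h]; rfl)
  have h1 : ∫ z, f z * X z =
      ∫ z, f z * (backKernel κ ⋆[lsmul ℝ ℝ, (volume : Measure (ℝ × E))] uncurry g) z := by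
    refine integral_congr_ae (Eventually.of_forall fun z => ?_)
    by_cases hz : f z = 0
    · simp [hz]
    · simp only [hX z hz]
  rw [h1]
  exact integral_mul_convolution_comm
    (hK.integrable_kernelPairing_swap hfi hfsupp hgi hM0
      (ae_of_all _ fun w => by rw [← Real.norm_eq_abs]; exact hM w.1 w.2) (ae_of_all _ hgsupp))

/-- The reflected-kernel potential of a backward kernel, written forward in time:
`(Ǩ ⋆ f)(t, x) = ∫ 1_{s < t} κ(t - s)(y - x) f(s, y) d(s, y)`. [folklore] -/
theorem convolution_reflect_backKernel_apply (κ : ℝ → E → ℝ) (f : ℝ × E → ℝ) (w : ℝ × E) :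
    ((fun v => backKernel κ (-v)) ⋆[lsmul ℝ ℝ, (volume : Measure (ℝ × E))] f) w =
      ∫ z : ℝ × E, (if z.1 < w.1 then κ (w.1 - z.1) (z.2 - w.2) else 0) * f z := by
  rw [convolution_reflect_lsmul_real_prod_apply]
  refine integral_congr_ae (Eventually.of_forall fun z => ?_)
  unfold backKernel
  simp only [Prod.fst_sub, Prod.snd_sub, sub_neg, neg_sub]

end General

/-! ### The Newtonian families for general viscosity (dimension three) -/

section Newton

variable {r₀ r₁ ν : ℝ} {g : ℝ → (EuclideanSpace ℝ (Fin 3)) → ℝ}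

variable (hg : IsSpaceTimeTestOn (⊤ : Opens (ℝ × (EuclideanSpace ℝ (Fin 3)))) g)
  (h₀ : 0 < r₀) (h₁ : r₀ < r₁) (hν : 0 < ν)
include hg h₀ h₁ hν

/-- **`Ξ = 𝒰_ν[∂_c N[g]]` is the potential of `g` against `backKernel (a ↦ heatD1 (νa) c Γ₀)`**,
at every point. [folklore] -/
theorem heatDuhamelBack_fderiv_newtonNearPotential_eq_convolution_nu
    (c : EuclideanSpace ℝ (Fin 3)) (s : ℝ) (x : EuclideanSpace ℝ (Fin 3)) :
    heatDuhamelBack ν (fun t y => fderiv ℝ (newtonNearPotential r₀ r₁ (g t)) y c) s x =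
      (backKernel (fun a y => heatD1 (ν * a) c (newtonNear r₀ r₁) y) ⋆[lsmul ℝ ℝ,
        (volume : Measure (ℝ × (EuclideanSpace ℝ (Fin 3))))] uncurry g) (s, x) := by
  refine heatDuhamelBack_eq_convolution_backKernel_nu
    (κ := fun b y => heatD1 b c (newtonNear r₀ r₁) y) s x (fun σ hσ => ?_)
    (((isSliceBoundKernel_backKernel_heatD1_newtonNear h₀ h₁ c).timeScale hν).integrable_backKernel_mul_test
      hg s x)
  rw [newtonNearPotential_eq_convolution]
  exact heatExtension_fderiv_convolution_eq_integral (integrable_newtonNear h₀.le h₁)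
    (hasCompactSupport_newtonNear h₀.le h₁) (hg.contDiff_slice (s + σ))
    (hg.hasCompactSupport_slice (s + σ)) (mul_pos hν hσ) c x

/-- **`∂ᵥΞ` is the potential of `g` against `backKernel (a ↦ heatD2 (νa) v c Γ₀)` off the
diagonal**: at every `(s, x)` with `δ ≤ ‖x - y‖` for all `y` in the spatial support of `g`. [folklore] -/
theorem fderiv_heatDuhamelBack_fderiv_newtonNearPotential_eq_convolution_nu
    (v c : EuclideanSpace ℝ (Fin 3)) {δ : ℝ} (hδ : 0 < δ) {A : Set (EuclideanSpace ℝ (Fin 3))}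
    (hA : ∀ t y, g t y ≠ 0 → y ∈ A) (s : ℝ) (x : EuclideanSpace ℝ (Fin 3))
    (hx : ∀ a ∈ A, δ ≤ ‖x - a‖) :
    fderiv ℝ (heatDuhamelBack ν (fun t y => fderiv ℝ (newtonNearPotential r₀ r₁ (g t)) y c) s) x v =
      (backKernel (fun a y => heatD2 (ν * a) v c (newtonNear r₀ r₁) y) ⋆[lsmul ℝ ℝ,
        (volume : Measure (ℝ × (EuclideanSpace ℝ (Fin 3))))] uncurry g) (s, x) := by
  have hΘ := isSpaceTimeTestOn_fderiv_newtonNearPotential_top hg h₀ h₁ c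
  rw [hΘ.fderiv_heatDuhamelBack_apply hν s x v]
  refine heatDuhamelBack_eq_convolution_backKernel_nu
    (κ := fun b y => heatD2 b v c (newtonNear r₀ r₁) y) s x (fun σ hσ => ?_)
    (((isOffDiagKernel_backKernel_heatD2_newtonNear h₀ h₁ hδ v c).timeScale hν).integrable_backKernel_mul_test
      hg hA s x (fun a ha => hx a ha))
  simp only [newtonNearPotential_eq_convolution]
  exact heatExtension_fderiv_fderiv_convolution_eq_integral (integrable_newtonNear h₀.le h₁)
    (hasCompactSupport_newtonNear h₀.le h₁) (hg.contDiff_slice (s + σ))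
    (hg.hasCompactSupport_slice (s + σ)) (mul_pos hν hσ) v c x

/-- **`∂ᵤ∂ᵥΞ` is the potential of `g` against `backKernel (a ↦ heatD3 (νa) u v c Γ₀)`** at every
point, for `‖u‖, ‖v‖, ‖c‖ ≤ 1`. [folklore] -/
theorem fderiv_fderiv_heatDuhamelBack_fderiv_newtonNearPotential_eq_convolution_nu
    {u v c : EuclideanSpace ℝ (Fin 3)} (hu : ‖u‖ ≤ 1) (hv : ‖v‖ ≤ 1) (hc : ‖c‖ ≤ 1) (s : ℝ)
    (x : EuclideanSpace ℝ (Fin 3)) :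
    fderiv ℝ (fun x' => fderiv ℝ
      (heatDuhamelBack ν (fun t y => fderiv ℝ (newtonNearPotential r₀ r₁ (g t)) y c) s) x' v) x u =
      (backKernel (fun a y => heatD3 (ν * a) u v c (newtonNear r₀ r₁) y) ⋆[lsmul ℝ ℝ,
        (volume : Measure (ℝ × (EuclideanSpace ℝ (Fin 3))))] uncurry g) (s, x) := by
  have hΘ := isSpaceTimeTestOn_fderiv_newtonNearPotential_top hg h₀ h₁ c
  have hΘv := hΘ.fderiv_apply_top v
  have step1 : (fun x' => fderiv ℝ
      (heatDuhamelBack ν (fun t y => fderiv ℝ (newtonNearPotential r₀ r₁ (g t)) y c) s) x' v) =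
      heatDuhamelBack ν (fun t y => fderiv ℝ (fun y' =>
        fderiv ℝ (newtonNearPotential r₀ r₁ (g t)) y' c) y v) s :=
    funext fun x' => hΘ.fderiv_heatDuhamelBack_apply hν s x' v
  rw [step1, hΘv.fderiv_heatDuhamelBack_apply hν s x u]
  obtain ⟨C, hC, hK⟩ := exists_isSliceBoundKernel_backKernel_heatD3_newtonNear h₀ h₁ hu hv hc
  refine heatDuhamelBack_eq_convolution_backKernel_nu
    (κ := fun b y => heatD3 b u v c (newtonNear r₀ r₁) y) s x (fun σ hσ => ?_)
    ((hK.timeScale hν).integrable_backKernel_mul_test hg s x)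
  simp only [newtonNearPotential_eq_convolution]
  exact heatExtension_fderiv3_convolution_eq_integral (integrable_newtonNear h₀.le h₁)
    (hasCompactSupport_newtonNear h₀.le h₁) (hg.contDiff_slice (s + σ))
    (hg.hasCompactSupport_slice (s + σ)) (mul_pos hν hσ) u v c x

/-- **`𝒰_ν[Λ[∂_c g]]` is the potential of `g` against `backKernel (a ↦ heatD1 (νa) c λ)`** at every
point. [folklore] -/
theorem heatDuhamelBack_newtonFarSmoothing_fderiv_eq_convolution_nu
    (c : EuclideanSpace ℝ (Fin 3)) (s : ℝ) (x : EuclideanSpace ℝ (Fin 3)) :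
    heatDuhamelBack ν (fun t y => newtonFarSmoothing r₀ r₁ (fun y' => fderiv ℝ (g t) y' c) y) s x =
      (backKernel (fun a y => heatD1 (ν * a) c (newtonFarLaplacian r₀ r₁) y) ⋆[lsmul ℝ ℝ,
        (volume : Measure (ℝ × (EuclideanSpace ℝ (Fin 3))))] uncurry g) (s, x) := by
  refine heatDuhamelBack_eq_convolution_backKernel_nu
    (κ := fun b y => heatD1 b c (newtonFarLaplacian r₀ r₁) y) s x (fun σ hσ => ?_)
    (((isOffDiagKernel_backKernel_heatD1_newtonFarLaplacian h₀ h₁ c).timeScale hν).integrable_backKernel_mul_test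
      hg (A := univ) (fun _ _ _ => mem_univ _) s x (fun _ _ => mem_univ _))
  -- `Λ[∂_c h] = ∂_c Λ[h] = ∂_c (λ ⋆ h)`
  have h1 : (fun y => newtonFarSmoothing r₀ r₁ (fun y' => fderiv ℝ (g (s + σ)) y' c) y) =
      fun y => fderiv ℝ (newtonFarLaplacian r₀ r₁ ⋆[lsmul ℝ ℝ,
        (volume : Measure (EuclideanSpace ℝ (Fin 3)))] g (s + σ)) y c := by
    funext y
    rw [← newtonFarSmoothing_eq_convolution,
      fderiv_newtonFarSmoothing_apply h₀ h₁ ((hg.contDiff_slice (s + σ)).of_le (by exact_mod_cast le_top))]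
  rw [h1]
  exact heatExtension_fderiv_convolution_eq_integral (integrable_newtonFarLaplacian h₀ h₁)
    (hasCompactSupport_newtonFarLaplacian h₀.le h₁) (hg.contDiff_slice (s + σ))
    (hg.hasCompactSupport_slice (s + σ)) (mul_pos hν hσ) c x

end Newton

end Literature.Analysis.FluidPDE
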